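import Summits.HubbardSuperconductivity.HubbardSuperconductivity.Theorems.AnisotropyChordTransferGapMonotone
import Summits.HubbardSuperconductivity.HubbardSuperconductivity.Theorems.AnisotropyChordTransferOneLink
import Summits.HubbardSuperconductivity.HubbardSuperconductivity.Theorems.AnisotropyChordTransferSpinSquared
import Summits.HubbardSuperconductivity.HubbardSuperconductivity.Theorems.AnisotropyChordTransferLinearLemmaX
import Summits.HubbardSuperconductivity.HubbardSuperconductivity.Theorems.AnisotropyChordTransferLadderBound
import Summits.HubbardSuperconductivity.HubbardSuperconductivity.Theorems.AnisotropyChordTowerCounting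
import Summits.HubbardSuperconductivity.HubbardSuperconductivity.Theorems.AnisotropyChordTowerLowestWeight
import Summits.HubbardSuperconductivity.HubbardSuperconductivity.Theorems.AnisotropyChordTowerSectorSpace
import Summits.HubbardSuperconductivity.HubbardSuperconductivity.Theorems.AnisotropyChordTowerBridge
import Summits.HubbardSuperconductivity.HubbardSuperconductivity.Theorems.AnisotropyChordInsertionEntropyUniformDensity
import Summits.HubbardSuperconductivity.HubbardSuperconductivity.Theorems.AnisotropyChordTransferFsumBound

/-!
# Route `AnisotropyChord` / H0 rotor rung — PART N21(a): THE LIFT INEQUALITY `sectorGapAtLeast_of_lift`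

Verbatim port (split at 400 lines; part (a) = definitions `liftShift`, `groundLift` and LEMMA 19.1) of the theory seat
`hubbard-h0-rotor-theory-1` cycle-19 file `cycle19/lean/PartN21.lean` (sha16 f6731c0994a9c97e, memo ROTOR-THEORY-19 §230/§234),
typed for the S-bridge dossier of stmt-HubbardSuperconductivity-19089.  PROVED here (no `sorry`, no new axioms):

* `liftShift_le_isingW` : on the sector with `n = |V|/2 + M` particles the Ising bond sum satisfies `W(σ) ≥ D/8 − 2n`
  (`D = Σ_x Σ_y [x ∼ y]`; every particle breaks at most `deg ≤ 4` bonds);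
* `energyQ_one_le` : for `Δ ≤ 1` the quadratic form is monotone up to the sector constant:
  `⟨φ, H(1) φ⟩ + (1 − Δ)(D/8 − 2n)‖φ‖² ≤ ⟨φ, H(Δ) φ⟩`;
* `groundLift_nonneg` : the ground lift `t₀(Δ, M) := E_Δ(M) − E_1(M) − (1 − Δ)(D/8 − 2n)` is `≥ 0`;
* `sectorGapAtLeast_of_lift` (**LEMMA 19.1**, the lift inequality): a Temple-form gap `g` at the ferromagnetic point
  `Δ = 1` and a bound `t₀(Δ, M) ≤ t` give the Temple-form gap `g − t` at `Δ` — a two-dimensional Courant–Fischer elimination;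

Part (b) (`nearEnd_of_ferroSectorGapCLR`, `groundLift_le_tangent`, `nearEnd_uniform`) is the companion file
`AnisotropyChordTransferNearEnd.lean`.
-/

set_option linter.dupNamespace false


open Finset
open Literature.MathematicalPhysics.QuantumLattice Literature.Probability.LatticeModels
open Summit.HubbardSuperconductivity.HubbardSuperconductivity.Theorems.AnisotropyChord.InsertionEntropy
open Summit.HubbardSuperconductivity.HubbardSuperconductivity.Theorems.AnisotropyChord.Tower
open Summit.HubbardSuperconductivity.HubbardSuperconductivity.Theorems.AnisotropyChord

namespace Summit.HubbardSuperconductivity.HubbardSuperconductivity.Theorems.AnisotropyChord.Transfer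

variable {L : ℕ} [NeZero L]

/-- the sector constant `c(M) = D/8 − (D/2|V|)·n = D/8 − (deg/2)·n`, `n = |V|/2 + M` (`D = adjCount` = number of ordered adjacent
site pairs, `deg = D/|V|` the common vertex degree; `= D/8 − 2n` for `L ≥ 3`). [folklore] -/
noncomputable def liftShift (L : ℕ) [NeZero L] (M : ℝ) : ℝ :=
  (1/8 : ℝ) * adjCount (torusGraph 2 L)
    - adjCount (torusGraph 2 L) / (2 * (Fintype.card (TorusSite 2 L) : ℝ)) * ((Fintype.card (TorusSite 2 L) : ℝ) / 2 + M)

/-- the GROUND LIFT `t₀(Δ, M) := E_Δ(M) − E_1(M) − (1 − Δ)·c(M)` (memo ROTOR-THEORY-19 §230; `= ẽ₀ + 2n` of the ED logs). [folklore] -/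
noncomputable def groundLift (L : ℕ) [NeZero L] (Δ M : ℝ) : ℝ :=
  sectorE L Δ M - sectorE L 1 M - (1 - Δ) * liftShift L M

/-- ordered intra-particle pair count is non-negative. [folklore] -/
theorem insideOrd_nonneg' (σ : TensorIndex (TorusSite 2 L) 2) : 0 ≤ insideOrd (torusGraph 2 L) σ := by
  unfold insideOrd
  exact Finset.sum_nonneg fun x _ => Finset.sum_nonneg fun y _ => by split_ifs <;> norm_num

/-- the ordered edge count is `|V|·deg` (constant degree, `torus_degree_const`). [folklore] -/
theorem adjCount_eq_card_mul_degree :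
    adjCount (torusGraph 2 L)
      = (Fintype.card (TorusSite 2 L) : ℝ) * (((univ.filter fun z : TorusSite 2 L => (torusGraph 2 L).Adj 0 z).card : ℕ) : ℝ) := by
  unfold adjCount
  simp_rw [torus_degree_const (L := L)]
  rw [Finset.sum_const, Finset.card_univ, nsmul_eq_mul]

/-- **counting bound:** on the sector `zerosCard σ = |V|/2 + M`, `W(σ) ≥ D/8 − (deg/2)(|V|/2 + M)`
(every particle breaks at most `deg` bonds). [folklore] -/
theorem liftShift_le_isingW (M : ℝ) (σ : TensorIndex (TorusSite 2 L) 2)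
    (hσ : zerosCard σ = (Fintype.card (TorusSite 2 L) : ℝ) / 2 + M) :
    liftShift L M ≤ isingW (torusGraph 2 L) σ := by
  have hreg := torus_degree_const (L := L)
  set d : ℕ := (univ.filter fun z : TorusSite 2 L => (torusGraph 2 L).Adj 0 z).card with hd
  have hcount := degree_count (torusGraph 2 L) d hreg σ
  have hz : 0 ≤ zerosCard σ := by unfold zerosCard; positivity
  have hin := insideOrd_nonneg' (L := L) σ
  have hbr : brokenOrd (torusGraph 2 L) σ ≤ (d : ℝ) * zerosCard σ := by linarith
  have hW := isingW_eq (torusGraph 2 L) σ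
  have hD : (∑ x : TorusSite 2 L, ∑ y, if (torusGraph 2 L).Adj x y then (1:ℝ) else 0) = adjCount (torusGraph 2 L) := rfl
  rw [hD] at hW
  have hVpos : (0 : ℝ) < (Fintype.card (TorusSite 2 L) : ℝ) := by exact_mod_cast Fintype.card_pos
  have hdeg : adjCount (torusGraph 2 L) / (2 * (Fintype.card (TorusSite 2 L) : ℝ)) = (d : ℝ) / 2 := by
    rw [adjCount_eq_card_mul_degree, ← hd]
    field_simp
  unfold liftShift
  rw [hdeg, hW, ← hσ]
  nlinarith [hbr, hz]

/-- **form monotonicity up to the sector constant:** for `Δ ≤ 1` and `φ` supported on the sector `M`,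
`⟨φ, H(1)φ⟩ + (1 − Δ)·c(M)·Σφ² ≤ ⟨φ, H(Δ)φ⟩`. [folklore] -/
theorem energyQ_one_le {Δ M : ℝ} (hΔ : Δ ≤ 1) (φ : TensorIndex (TorusSite 2 L) 2 → ℝ)
    (hφ : ∀ σ, φ σ ≠ 0 → zerosCard σ = (Fintype.card (TorusSite 2 L) : ℝ) / 2 + M) :
    energyQ L 1 φ + (1 - Δ) * liftShift L M * ∑ σ, φ σ ^ 2 ≤ energyQ L Δ φ := by
  rw [energyQ_eq_real, energyQ_eq_real]
  have hpt : ∀ σ, (1 - Δ) * liftShift L M * φ σ ^ 2 ≤ (1 - Δ) * (isingW (torusGraph 2 L) σ * φ σ ^ 2) := by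
    intro σ
    by_cases h0 : φ σ = 0
    · simp [h0]
    · have hW := liftShift_le_isingW (L := L) M σ (hφ σ h0)
      have h1 : 0 ≤ 1 - Δ := by linarith
      have h2 : 0 ≤ φ σ ^ 2 := sq_nonneg _
      nlinarith [mul_nonneg h1 h2]
  have hsum : (1 - Δ) * liftShift L M * ∑ σ, φ σ ^ 2 ≤ ∑ σ, (1 - Δ) * (isingW (torusGraph 2 L) σ * φ σ ^ 2) := by
    rw [Finset.mul_sum]
    exact Finset.sum_le_sum fun σ _ => hpt σ
  have hsplitΔ : (∑ σ, φ σ * (fmOp (torusGraph 2 L) φ σ + (1 - Δ) * (isingW (torusGraph 2 L) σ * φ σ)))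
      = (∑ σ, φ σ * fmOp (torusGraph 2 L) φ σ) + ∑ σ, (1 - Δ) * (isingW (torusGraph 2 L) σ * φ σ ^ 2) := by
    rw [← Finset.sum_add_distrib]
    exact Finset.sum_congr rfl fun σ _ => by ring
  have hsplit1 : (∑ σ, φ σ * (fmOp (torusGraph 2 L) φ σ + (1 - (1:ℝ)) * (isingW (torusGraph 2 L) σ * φ σ)))
      = ∑ σ, φ σ * fmOp (torusGraph 2 L) φ σ := Finset.sum_congr rfl fun σ _ => by ring
  rw [hsplitΔ, hsplit1]
  linarith

/-- the Perron amplitude's energy is the sector ground energy: `⟨a, H(Δ) a⟩ = E_Δ(M)`. [folklore] -/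
theorem perron_energyQ {Δ M : ℝ} {a : TensorIndex (TorusSite 2 L) 2 → ℝ}
    (ha : IsPerronSectorGroundAmplitude L Δ M a) : energyQ L Δ a = sectorE L Δ M := by
  rw [energyQ_eq_real, perron_energy_real ha, ha.unit]
  unfold sectorE ham
  ring

/-- **LEMMA 19.1 (i): the ground lift is non-negative** (`Δ ≤ 1`; needs a Perron amplitude of the sector at `Δ`). [folklore] -/
theorem groundLift_nonneg {Δ M : ℝ} (hΔ : Δ ≤ 1) {a : TensorIndex (TorusSite 2 L) 2 → ℝ}
    (ha : IsPerronSectorGroundAmplitude L Δ M a) : 0 ≤ groundLift L Δ M := by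
  have hsupp : ∀ σ, a σ ≠ 0 → zerosCard σ = (Fintype.card (TorusSite 2 L) : ℝ) / 2 + M :=
    fun σ hσ => zerosCard_of_mem_spinZSector ha.sector σ hσ
  have h1 := sectorE_mul_le_energyQ (1:ℝ) M a hsupp
  have h2 := energyQ_one_le hΔ a hsupp
  rw [ha.unit] at h1 h2
  have h3 := perron_energyQ ha
  unfold groundLift
  linarith

/-- real eigen-relation of a Perron amplitude in `sectorE` currency. [folklore] -/
theorem perron_eigen_sectorE {Δ M : ℝ} {a : TensorIndex (TorusSite 2 L) 2 → ℝ}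
    (ha : IsPerronSectorGroundAmplitude L Δ M a) (σ : TensorIndex (TorusSite 2 L) 2) :
    fmOp (torusGraph 2 L) a σ + (1 - Δ) * (isingW (torusGraph 2 L) σ * a σ)
      = (sectorE L Δ M + (1/8 : ℝ) * ∑ x : TorusSite 2 L, ∑ y, if (torusGraph 2 L).Adj x y then (1:ℝ) else 0) * a σ := by
  unfold sectorE ham
  exact perron_eigen_real ha σ

/-- `Σ (αu + βv)² = α² Σu² + 2αβ Σuv + β² Σv²`. [folklore] -/
theorem sum_comb_sq (α β : ℝ) (u v w : TensorIndex (TorusSite 2 L) 2 → ℝ) (hw : ∀ σ, w σ = α * u σ + β * v σ) :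
    ∑ σ, w σ ^ 2 = α ^ 2 * ∑ σ, u σ ^ 2 + 2 * α * β * ∑ σ, u σ * v σ + β ^ 2 * ∑ σ, v σ ^ 2 := by
  have h : ∀ σ, w σ ^ 2 = α ^ 2 * u σ ^ 2 + 2 * α * β * (u σ * v σ) + β ^ 2 * v σ ^ 2 := fun σ => by rw [hw σ]; ring
  simp only [h, Finset.sum_add_distrib, ← Finset.mul_sum]

/-- `Σ z(αu + βv) = α Σ zu + β Σ zv`. [folklore] -/
theorem sum_mul_comb (α β : ℝ) (z u v w : TensorIndex (TorusSite 2 L) 2 → ℝ) (hw : ∀ σ, w σ = α * u σ + β * v σ) :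
    ∑ σ, z σ * w σ = α * ∑ σ, z σ * u σ + β * ∑ σ, z σ * v σ := by
  have h : ∀ σ, z σ * w σ = α * (z σ * u σ) + β * (z σ * v σ) := fun σ => by rw [hw σ]; ring
  simp only [h, Finset.sum_add_distrib, ← Finset.mul_sum]

/-- **expansion of the real form on `span{ψ, a}`** when `a` is an eigen-amplitude (`(A + (1−Δ)W) a = e'·a`):
for `χ = pψ + qa`, `q(χ) = p² q(ψ) + 2pq e'⟨ψ,a⟩ + q² e' Σa²`. [folklore] -/
theorem realForm_expand (Δ e' p q : ℝ) (ψ a χ : TensorIndex (TorusSite 2 L) 2 → ℝ)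
    (he : ∀ σ, fmOp (torusGraph 2 L) a σ + (1 - Δ) * (isingW (torusGraph 2 L) σ * a σ) = e' * a σ)
    (hχ : ∀ σ, χ σ = p * ψ σ + q * a σ) :
    (∑ σ, χ σ * (fmOp (torusGraph 2 L) χ σ + (1 - Δ) * (isingW (torusGraph 2 L) σ * χ σ)))
      = p ^ 2 * (∑ σ, ψ σ * (fmOp (torusGraph 2 L) ψ σ + (1 - Δ) * (isingW (torusGraph 2 L) σ * ψ σ)))
        + 2 * p * q * e' * (∑ σ, ψ σ * a σ) + q ^ 2 * e' * ∑ σ, a σ ^ 2 := by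
  -- linearity of `A`
  have hχfun : χ = p • ψ + q • a := by
    funext τ; rw [Pi.add_apply, Pi.smul_apply, Pi.smul_apply, smul_eq_mul, smul_eq_mul, hχ τ]
  have hlin : ∀ σ, fmOp (torusGraph 2 L) χ σ = p * fmOp (torusGraph 2 L) ψ σ + q * fmOp (torusGraph 2 L) a σ := by
    intro σ
    rw [hχfun, fmOp_add', fmOp_smul', fmOp_smul', Pi.add_apply, Pi.smul_apply, Pi.smul_apply, smul_eq_mul, smul_eq_mul]
  -- the `F`-images: Fψ and Fa = e' a
  set Fψ : TensorIndex (TorusSite 2 L) 2 → ℝ :=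
    fun σ => fmOp (torusGraph 2 L) ψ σ + (1 - Δ) * (isingW (torusGraph 2 L) σ * ψ σ) with hFψ
  have hFχ : ∀ σ, fmOp (torusGraph 2 L) χ σ + (1 - Δ) * (isingW (torusGraph 2 L) σ * χ σ) = p * Fψ σ + q * (e' * a σ) := by
    intro σ
    rw [hlin σ, hχ σ, ← he σ, hFψ]
    ring
  -- symmetry: Σ a·Fψ = Σ (Fa)·ψ = e' Σ ψ a
  have hsymm : (∑ σ, a σ * fmOp (torusGraph 2 L) ψ σ) = ∑ σ, fmOp (torusGraph 2 L) a σ * ψ σ :=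
    sum_mul_fmOp_comm (torusGraph 2 L) a ψ
  have hcross : (∑ σ, a σ * Fψ σ) = e' * ∑ σ, ψ σ * a σ := by
    have h1 : (∑ σ, a σ * Fψ σ) = (∑ σ, a σ * fmOp (torusGraph 2 L) ψ σ)
        + ∑ σ, (1 - Δ) * (isingW (torusGraph 2 L) σ * ψ σ * a σ) := by
      rw [← Finset.sum_add_distrib]; exact Finset.sum_congr rfl fun σ _ => by rw [hFψ]; ring
    rw [h1, hsymm, ← Finset.sum_add_distrib, Finset.mul_sum]
    refine Finset.sum_congr rfl fun σ _ => ?_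
    have h2 := he σ
    calc fmOp (torusGraph 2 L) a σ * ψ σ + (1 - Δ) * (isingW (torusGraph 2 L) σ * ψ σ * a σ)
        = (fmOp (torusGraph 2 L) a σ + (1 - Δ) * (isingW (torusGraph 2 L) σ * a σ)) * ψ σ := by ring
      _ = e' * a σ * ψ σ := by rw [h2]
      _ = e' * (ψ σ * a σ) := by ring
  -- expand Σ χ·Fχ = Σ (pψ + qa)(pFψ + q e' a)
  have hsum : (∑ σ, χ σ * (fmOp (torusGraph 2 L) χ σ + (1 - Δ) * (isingW (torusGraph 2 L) σ * χ σ)))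
      = p ^ 2 * (∑ σ, ψ σ * Fψ σ) + p * q * (∑ σ, a σ * Fψ σ) + p * q * (e' * ∑ σ, ψ σ * a σ)
        + q ^ 2 * (e' * ∑ σ, a σ ^ 2) := by
    have hpt : ∀ σ, χ σ * (fmOp (torusGraph 2 L) χ σ + (1 - Δ) * (isingW (torusGraph 2 L) σ * χ σ))
        = p ^ 2 * (ψ σ * Fψ σ) + p * q * (a σ * Fψ σ) + p * q * (e' * (ψ σ * a σ)) + q ^ 2 * (e' * a σ ^ 2) := by
      intro σ; rw [hFχ σ, hχ σ]; ring
    simp only [hpt, Finset.sum_add_distrib, ← Finset.mul_sum]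
  rw [hsum, hcross]
  have hq : (∑ σ, ψ σ * Fψ σ) = ∑ σ, ψ σ * (fmOp (torusGraph 2 L) ψ σ + (1 - Δ) * (isingW (torusGraph 2 L) σ * ψ σ)) :=
    Finset.sum_congr rfl fun σ _ => by rw [hFψ]
  rw [hq]
  ring

set_option maxHeartbeats 800000 in
/-- **LEMMA 19.1 (iii) — THE LIFT INEQUALITY.**  For `Δ ≤ 1`: a Temple-form sector gap `g` at the ferromagnetic point and
a bound `t₀(Δ, M) ≤ t` on the ground lift give the Temple-form sector gap `g − t` at `Δ`.
(Courant–Fischer on `span{a_Δ, ψ}`: test the `Δ = 1` hypothesis on `χ = ⟨a₁,a_Δ⟩ψ − ⟨a₁,ψ⟩a_Δ ⊥ a₁.)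
[new: theory seat hubbard-h0-rotor-theory-1, cycle 19, memo ROTOR-THEORY-19 §230] -/
theorem sectorGapAtLeast_of_lift {Δ M g t : ℝ} (hΔ : Δ ≤ 1)
    (h1 : SectorGapAtLeast L 1 M g) (ht : groundLift L Δ M ≤ t) :
    SectorGapAtLeast L Δ M (g - t) := by
  intro a φ ha hφ hunit
  -- generalised abbreviations (opaque reals with defining equations)
  obtain ⟨D, hD⟩ : ∃ D : ℝ, D = ∑ x : TorusSite 2 L, ∑ y, if (torusGraph 2 L).Adj x y then (1:ℝ) else 0 := ⟨_, rfl⟩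
  obtain ⟨EΔ, hEΔ⟩ : ∃ E : ℝ, E = sectorE L Δ M := ⟨_, rfl⟩
  obtain ⟨E1, hE1⟩ : ∃ E : ℝ, E = sectorE L 1 M := ⟨_, rfl⟩
  obtain ⟨c, hc⟩ : ∃ c : ℝ, c = liftShift L M := ⟨_, rfl⟩
  obtain ⟨s, hs⟩ : ∃ s : ℝ, s = ∑ σ, a σ * φ σ := ⟨_, rfl⟩
  rw [← hs, ← hEΔ]
  have hlift : EΔ - E1 - (1 - Δ) * c ≤ t := by rw [hEΔ, hE1, hc]; exact ht
  -- supports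
  have hsuppφ : ∀ σ, φ σ ≠ 0 → zerosCard σ = (Fintype.card (TorusSite 2 L) : ℝ) / 2 + M :=
    fun σ hσ => zerosCard_of_mem_spinZSector hφ σ hσ
  have hsuppa : ∀ σ, a σ ≠ 0 → zerosCard σ = (Fintype.card (TorusSite 2 L) : ℝ) / 2 + M :=
    fun σ hσ => zerosCard_of_mem_spinZSector ha.sector σ hσ
  -- the right side is non-negative (variational floor) and s² ≤ 1 (Cauchy–Schwarz)
  have hR0 : 0 ≤ energyQ L Δ φ - EΔ := by
    have h := sectorE_mul_le_energyQ Δ M φ hsuppφ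
    rw [hunit, mul_one, ← hEΔ] at h
    linarith
  have hs1 : s ^ 2 ≤ 1 := by
    have hcs := Finset.sum_mul_sq_le_sq_mul_sq (Finset.univ) a φ
    rw [ha.unit, hunit, ← hs] at hcs
    linarith
  by_cases hgt : g - t ≤ 0
  · have : (g - t) * (1 - s ^ 2) ≤ 0 := mul_nonpos_iff.2 (Or.inr ⟨hgt, by linarith⟩)
    linarith
  push Not at hgt
  by_cases hs0 : 1 - s ^ 2 ≤ 0
  · have : (g - t) * (1 - s ^ 2) ≤ 0 := mul_nonpos_iff.2 (Or.inl ⟨hgt.le, hs0⟩)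
    linarith
  push Not at hs0
  -- the Perron amplitude at the ferromagnetic point
  obtain ⟨a₁, ha₁⟩ := exists_perronAmplitude L 1 M (spinZSector_ne_bot_of_perron ha)
  -- eigen-relation of `a` at `Δ` with eigenvalue `e' = EΔ + D/8`
  have he : ∀ σ, fmOp (torusGraph 2 L) a σ + (1 - Δ) * (isingW (torusGraph 2 L) σ * a σ) = (EΔ + (1/8 : ℝ) * D) * a σ := by
    intro σ; rw [hEΔ, hD]; exact perron_eigen_sectorE ha σ
  have hEa : energyQ L Δ a = EΔ := by rw [hEΔ]; exact perron_energyQ ha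
  -- ψ := φ − s a  (⊥ a, norm² = 1 − s²)
  obtain ⟨ψ, hψ⟩ : ∃ ψ : TensorIndex (TorusSite 2 L) 2 → ℝ, ∀ σ, ψ σ = (-s) * a σ + 1 * φ σ :=
    ⟨fun σ => (-s) * a σ + 1 * φ σ, fun σ => rfl⟩
  have hψa : ∑ σ, ψ σ * a σ = 0 := by
    have h := sum_mul_comb (L := L) (-s) 1 a a φ ψ hψ
    have h' : ∑ σ, ψ σ * a σ = ∑ σ, a σ * ψ σ := Finset.sum_congr rfl fun σ _ => by ring
    have h'' : ∑ σ, a σ * a σ = ∑ σ, a σ ^ 2 := Finset.sum_congr rfl fun σ _ => by ring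
    rw [h', h, h'', ha.unit, ← hs]; ring
  have hψn : ∑ σ, ψ σ ^ 2 = 1 - s ^ 2 := by
    rw [sum_comb_sq (L := L) (-s) 1 a φ ψ hψ, ha.unit, hunit, ← hs]; ring
  have hsuppψ : ∀ σ, ψ σ ≠ 0 → zerosCard σ = (Fintype.card (TorusSite 2 L) : ℝ) / 2 + M := by
    intro σ hσ
    by_cases hφ0 : φ σ = 0
    · have : a σ ≠ 0 := by
        intro ha0; apply hσ; rw [hψ σ, hφ0, ha0]; ring
      exact hsuppa σ this
    · exact hsuppφ σ hφ0
  -- the real form of ψ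
  obtain ⟨Qψ, hQψ⟩ : ∃ Q : ℝ, Q = ∑ σ, ψ σ * (fmOp (torusGraph 2 L) ψ σ + (1 - Δ) * (isingW (torusGraph 2 L) σ * ψ σ)) :=
    ⟨_, rfl⟩
  -- (1) φ = s·a + 1·ψ, i.e. φ = 1·ψ + s·a :  energyQ Δ φ = Qψ + s² e' − D/8
  have hφψ : ∀ σ, φ σ = 1 * ψ σ + s * a σ := fun σ => by rw [hψ σ]; ring
  have hEφ : energyQ L Δ φ = Qψ + s ^ 2 * (EΔ + (1/8 : ℝ) * D) - (1/8 : ℝ) * D := by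
    rw [energyQ_eq_real, ← hD, hunit, realForm_expand (L := L) Δ (EΔ + (1/8 : ℝ) * D) 1 s ψ a φ he hφψ, hψa, ha.unit, ← hQψ]
    ring
  -- p := ⟨a₁, a⟩, q := ⟨a₁, ψ⟩
  obtain ⟨p, hp⟩ : ∃ p : ℝ, p = ∑ σ, a₁ σ * a σ := ⟨_, rfl⟩
  obtain ⟨q, hq⟩ : ∃ q : ℝ, q = ∑ σ, a₁ σ * ψ σ := ⟨_, rfl⟩
  -- monotonicity for `a`: E1 ≤ energyQ 1 a ≤ EΔ − (1−Δ)c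
  have hmono_a := energyQ_one_le hΔ a hsuppa
  rw [ha.unit, mul_one, ← hc, hEa] at hmono_a
  -- case p = 0 : `a ⊥ a₁` is a unit test vector at Δ = 1 ⇒ g ≤ t, contradiction
  by_cases hp0 : p = 0
  · exfalso
    have h := h1 a₁ a ha₁ ha.sector ha.unit
    rw [← hp, hp0, ← hE1] at h
    norm_num at h
    linarith
  have hp2 : 0 < p ^ 2 := by positivity
  -- χ := p ψ − q a  (⊥ a₁),  N := Σχ² = p²(1−s²) + q² > 0
  obtain ⟨χ, hχ⟩ : ∃ χ : TensorIndex (TorusSite 2 L) 2 → ℝ, ∀ σ, χ σ = p * ψ σ + (-q) * a σ :=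
    ⟨fun σ => p * ψ σ + (-q) * a σ, fun σ => rfl⟩
  have hχa₁ : ∑ σ, a₁ σ * χ σ = 0 := by
    rw [sum_mul_comb (L := L) p (-q) a₁ ψ a χ hχ, ← hp, ← hq]; ring
  obtain ⟨N, hNdef⟩ : ∃ N : ℝ, N = p ^ 2 * (1 - s ^ 2) + q ^ 2 := ⟨_, rfl⟩
  have hNχ : ∑ σ, χ σ ^ 2 = N := by
    rw [sum_comb_sq (L := L) p (-q) ψ a χ hχ, hψn, hψa, ha.unit, hNdef]; ring
  have hNpos : 0 < N := by
    have hprod := mul_pos hp2 hs0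
    rw [hNdef]; linarith [sq_nonneg q]
  have hsuppχ : ∀ σ, χ σ ≠ 0 → zerosCard σ = (Fintype.card (TorusSite 2 L) : ℝ) / 2 + M := by
    intro σ hσ
    by_cases hψ0 : ψ σ = 0
    · have : a σ ≠ 0 := by
        intro ha0; apply hσ; rw [hχ σ, hψ0, ha0]; ring
      exact hsuppa σ this
    · exact hsuppψ σ hψ0
  -- (2) the Δ = 1 hypothesis on the normalised vector χ' = r χ, r = 1/√N
  obtain ⟨r, hr⟩ : ∃ r : ℝ, r = 1 / Real.sqrt N := ⟨_, rfl⟩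
  have hr2 : r ^ 2 * N = 1 := by
    rw [hr, div_pow, one_pow, Real.sq_sqrt hNpos.le]; field_simp
  obtain ⟨χ', hχ'⟩ : ∃ χ' : TensorIndex (TorusSite 2 L) 2 → ℝ, ∀ σ, χ' σ = r * χ σ + 0 * a σ :=
    ⟨fun σ => r * χ σ + 0 * a σ, fun σ => rfl⟩
  have hχ'fun : χ' = r • χ := by
    funext σ; rw [Pi.smul_apply, smul_eq_mul, hχ' σ]; ring
  have hunitχ' : ∑ σ, χ' σ ^ 2 = 1 := by
    rw [sum_comb_sq (L := L) r 0 χ a χ' hχ', hNχ]; linear_combination hr2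
  have hsuppχ' : ∀ σ, χ' σ ≠ 0 → zerosCard σ = (Fintype.card (TorusSite 2 L) : ℝ) / 2 + M := by
    intro σ hσ
    have : χ σ ≠ 0 := by intro h0; apply hσ; rw [hχ' σ, h0]; ring
    exact hsuppχ σ this
  have hmemχ' : cplx L χ' ∈ spinZSector (Λ := TorusSite 2 L) 1 M := mem_spinZSector_of_support M χ' hsuppχ'
  have hinner : ∑ σ, a₁ σ * χ' σ = 0 := by
    rw [sum_mul_comb (L := L) r 0 a₁ χ a χ' hχ', hχa₁]; ring
  have hT := h1 a₁ χ' ha₁ hmemχ' hunitχ'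
  rw [hinner, hχ'fun, energyQ_smul, ← hE1] at hT
  -- g N ≤ energyQ 1 χ − N E1
  have hgN : g * N ≤ energyQ L 1 χ - N * E1 := by
    have h' : g ≤ r ^ 2 * energyQ L 1 χ - E1 := by norm_num at hT; linarith
    have h'' := mul_le_mul_of_nonneg_right h' hNpos.le
    calc g * N ≤ (r ^ 2 * energyQ L 1 χ - E1) * N := h''
      _ = (r ^ 2 * N) * energyQ L 1 χ - N * E1 := by ring
      _ = energyQ L 1 χ - N * E1 := by rw [hr2, one_mul]
  -- (3) monotonicity for χ, and N·(EΔ − (1−Δ)c − t) ≤ N·E1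
  have hmonoχ := energyQ_one_le hΔ χ hsuppχ
  rw [hNχ, ← hc] at hmonoχ
  have hliftN : N * EΔ - (1 - Δ) * c * N - t * N ≤ N * E1 := by
    have h' := mul_le_mul_of_nonneg_left hlift hNpos.le
    calc N * EΔ - (1 - Δ) * c * N - t * N = N * (EΔ - E1 - (1 - Δ) * c - t) + N * E1 := by ring
      _ ≤ N * t + N * E1 - N * t := by linarith
      _ = N * E1 := by ring
  have step3 : g * N ≤ energyQ L Δ χ - N * EΔ + t * N := by linarith [hgN, hmonoχ, hliftN]
  -- (4) expansion of energyQ Δ χ and the ring identity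
  have hEχ : energyQ L Δ χ = p ^ 2 * Qψ + q ^ 2 * (EΔ + (1/8 : ℝ) * D) - (1/8 : ℝ) * D * N := by
    rw [energyQ_eq_real, ← hD, hNχ, realForm_expand (L := L) Δ (EΔ + (1/8 : ℝ) * D) p (-q) ψ a χ he hχ, hψa, ha.unit, ← hQψ]
    ring
  have hident : p ^ 2 * (energyQ L Δ φ - EΔ) - (g - t) * N = (energyQ L Δ χ - N * EΔ + t * N) - g * N := by
    rw [hEχ, hEφ, hNdef]; ring
  have hkey : (g - t) * N ≤ p ^ 2 * (energyQ L Δ φ - EΔ) := by linarith [hident, step3]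
  -- conclude: N ≥ p²(1 − s²) and p² > 0
  have hNge : p ^ 2 * (1 - s ^ 2) ≤ N := by rw [hNdef]; linarith [sq_nonneg q]
  have hfin : p ^ 2 * ((g - t) * (1 - s ^ 2)) ≤ p ^ 2 * (energyQ L Δ φ - EΔ) := by
    calc p ^ 2 * ((g - t) * (1 - s ^ 2)) = (g - t) * (p ^ 2 * (1 - s ^ 2)) := by ring
      _ ≤ (g - t) * N := mul_le_mul_of_nonneg_left hNge hgt.le
      _ ≤ p ^ 2 * (energyQ L Δ φ - EΔ) := hkey
  exact le_of_mul_le_mul_left hfin hp2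

end Summit.HubbardSuperconductivity.HubbardSuperconductivity.Theorems.AnisotropyChord.Transfer
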